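import Mathlib
import Literature.Analysis.FluidPDE.Tao2016AveragedNS.ShiftSetCascadeFlows
import Summits.NavierStokesRegularity.NavierStokesRegularity.Theorems.TaoLadderRungTwoFlatCertificateGlueCheckerJetsOn
import Summits.NavierStokesRegularity.NavierStokesRegularity.Theorems.TaoLadderRungTwoFlatCertificateGlueLohnerCascadePerCompOn
import HarnessLib

/-!
# Certificate glue on a shift set `𝕊`, XXV-c: THE CHECKER'S BOX CLAUSES — dyadic vectors/matrices as real data, the centre bound
  `|x| ≤ mC` (C2), the frame row-sum test `|C ξ| ≤ ρC` on the `r`-box (C3), and the start-node inclusion of a box in a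
  parallelepiped (C12, first node) (helper for items stmt-NavierStokesRegularity-22987 `FlatGapCertificatesV2` (crux K_A♭ of route
  TaoLadderRungTwoFlat) and stmt-24295 K_A₂(64); cell harvest/h2-tao-ladder, p1 g15; CHECKER-SPEC-v3 §3 (ii)–(iii))

Data conventions for the step checker: a dyadic vector `Array Dyad` read by `dgetD` (glue XXV) denotes the real vector `dvec`; a
dyadic matrix `Array (Array Dyad)` read by `dmgetD` denotes the real matrix `dmat : Matrix (Fin n) (Fin n) ℝ`. Tests are exact
dyadic arithmetic (`Dyad.add/mul/abs/ble`); soundness lemmas state the hypotheses `hx` (C2), `hC` (C3) of glue XVIII/XIX-c and the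
start inclusion `Node ⊆ PInPara x 1 r 0` (C12) for the denoted real data.

HONEST FRAMING: Tao-type MODEL lattices (Tao 2016 §4/§6 vocabulary, shift-set parametrised); arithmetic soundness lemmas — no
certificate data, nothing certified, no stub closed, nothing about the Navier–Stokes equations.
-/

-- the sub-problem namespace repeats the summit name by design (D-0017)
set_option linter.dupNamespace false

namespace Summit.NavierStokesRegularity.NavierStokesRegularity.Theorems

open Set Finset Literature.Analysis.FluidPDE Literature.Analysis.FluidPDE.TaoCascade
open Summit.NavierStokesRegularity.NavierStokesRegularity.Theorems.TaylorModelCert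

namespace CertificateGlueOn

/-! ### Dyadic data as real vectors and matrices -/

/-- Entry `(r, c)` of a dyadic matrix (junk `0` beyond the size). [folklore] -/
def dmgetD (A : Array (Array Dyad)) (r c : ℕ) : Dyad :=
  if h : r < A.size then dgetD A[r] c else Dyad.ofInt 0

/-- The real vector denoted by a dyadic vector. [folklore] -/
noncomputable def dvec {n : ℕ} (v : Array Dyad) : Fin n → ℝ := fun c => (dgetD v c).toReal

/-- The real matrix denoted by a dyadic matrix. [folklore] -/
noncomputable def dmat {n : ℕ} (A : Array (Array Dyad)) : Matrix (Fin n) (Fin n) ℝ := fun r c => (dmgetD A r c).toReal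

/-! ### C2: the centre bound -/

/-- **The C2 test**: `|x_c| ≤ mC` for all `c < n`. [folklore] -/
def checkAbsLe (n : ℕ) (v : Array Dyad) (M : Dyad) : Bool := (List.range n).all fun c => Dyad.ble (Dyad.abs (dgetD v c)) M

/-- C2 from the test. [folklore] -/
theorem abs_le_of_checkAbsLe {n : ℕ} {v : Array Dyad} {M : Dyad} (h : checkAbsLe n v M = true) :
    ∀ c : Fin n, |dvec (n := n) v c| ≤ M.toReal := by
  intro c
  simp only [checkAbsLe, List.all_eq_true, List.mem_range, Dyad.ble_iff, Dyad.toReal_abs] at h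
  exact h c c.isLt

/-! ### C3: the frame row-sum test -/

/-- Exact dyadic `Σ_{d<n} |A r d| · w d`. [folklore] -/
def rowAbsDot (n : ℕ) (A : Array (Array Dyad)) (w : Array Dyad) (r : ℕ) : Dyad :=
  (List.range n).foldr (fun d acc => Dyad.add (Dyad.mul (Dyad.abs (dmgetD A r d)) (dgetD w d)) acc) (Dyad.ofInt 0)

/-- The value of `rowAbsDot`. [folklore] -/
theorem toReal_rowAbsDot (n : ℕ) (A : Array (Array Dyad)) (w : Array Dyad) (r : ℕ) :
    (rowAbsDot n A w r).toReal = ∑ d ∈ Finset.range n, |(dmgetD A r d).toReal| * (dgetD w d).toReal := by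
  unfold rowAbsDot
  induction n with
  | zero => simp
  | succ n ih =>
    rw [List.range_succ, List.foldr_append, Finset.sum_range_succ]
    simp only [List.foldr_cons, List.foldr_nil]
    have key : ∀ (l : List ℕ) (a : Dyad),
        (l.foldr (fun d acc => Dyad.add (Dyad.mul (Dyad.abs (dmgetD A r d)) (dgetD w d)) acc) a).toReal =
          (l.foldr (fun d acc => Dyad.add (Dyad.mul (Dyad.abs (dmgetD A r d)) (dgetD w d)) acc) (Dyad.ofInt 0)).toReal +
            a.toReal := by
      intro l a
      induction l with
      | nil => simp
      | cons d l ihl => simp [List.foldr_cons, ihl]; ring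
    rw [key, ih]
    simp

/-- **The C3 test**: every row sum `Σ_d |C r d| · r_d ≤ ρC`. [folklore] -/
def checkRowSum (n : ℕ) (A : Array (Array Dyad)) (w : Array Dyad) (ρ : Dyad) : Bool :=
  (List.range n).all fun r => Dyad.ble (rowAbsDot n A w r) ρ

/-- **C3 FROM THE TEST**: `|C ξ|_c ≤ ρC` for every `ξ` in the `r`-box — the hypothesis `hC` of glue XVIII/XIX-c for `C := dmat A`,
`r := dvec w`, `ρC := ρ.toReal`. [folklore] -/
theorem mulVec_le_of_checkRowSum {n : ℕ} {A : Array (Array Dyad)} {w : Array Dyad} {ρ : Dyad}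
    (h : checkRowSum n A w ρ = true) :
    ∀ ξ : Fin n → ℝ, (∀ c, |ξ c| ≤ dvec (n := n) w c) → ∀ c, |(dmat (n := n) A).mulVec ξ c| ≤ ρ.toReal := by
  intro ξ hξ c
  simp only [checkRowSum, List.all_eq_true, List.mem_range, Dyad.ble_iff] at h
  have hrow := h c c.isLt
  rw [toReal_rowAbsDot] at hrow
  have h1 : |(dmat (n := n) A).mulVec ξ c| ≤ ∑ d : Fin n, |(dmgetD A c d).toReal| * dvec (n := n) w d := by
    simp only [Matrix.mulVec, dotProduct, dmat]
    refine (Finset.abs_sum_le_sum_abs _ _).trans (Finset.sum_le_sum fun d _ => ?_)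
    rw [abs_mul]
    exact mul_le_mul_of_nonneg_left (hξ d) (abs_nonneg _)
  refine h1.trans (le_of_eq_of_le ?_ hrow)
  simp only [dvec]
  exact (Fin.sum_univ_eq_sum_range (fun d => |(dmgetD A c d).toReal| * (dgetD w d).toReal) n)

/-! ### C12: a box inside a parallelepiped (first node of a branch) -/

variable {m : ℕ} {Kb Ka : ℤ} {ω : Fin m → ℤ → ℝ}

/-- A state whose per-component weighted coordinates lie within `r` of `x` is in the parallelepiped `PInPara x 1 r 0` (identity
frame, no remainder) — the start-node inclusion for a branch BOX. [folklore] -/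
theorem pinPara_one_of_box {x r : Fin (m * winLen Kb Ka) → ℝ} {y : Fin m → ℤ → ℝ}
    (h : ∀ c, |pxcoord Kb Ka ω y c - x c| ≤ r c) : PInPara Kb Ka ω x 1 r 0 y := by
  refine ⟨pxcoord Kb Ka ω y - x, 0, fun c => by simpa using h c, fun c => by simp, ?_⟩
  simp

end CertificateGlueOn

end Summit.NavierStokesRegularity.NavierStokesRegularity.Theorems
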